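import Summits.CriticalPhenomena.PercolationContinuityZ3.Theorems.PercNearOneGluingNoHeavyLowerTailSahiCombHalfMix

/-!
# ORDER-1(3) implies HALF-MIX: `CombOrderOne 3 ⟹ HalfMix ⟹ Half ⟹` Kahn's Conjecture 5

Support file of the one-cut programme (crux `NoHeavyLowerTail`, stmt-CriticalPhenomena-4575; cell `prim-bnk`, seat bnk-2 gen 12,
memo `run/shared/lean/prim/prim-l12/FROM-prim-bnk-2-g12-MIX-RUNGS.md` §2(b)).  Companion of `…SahiCombMixRungs` / `…SahiCombHalfMix`.

The base of the lettered induction of `…SahiCombHalfMix` is a sum of HALF letters of comb LINES: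
`hmSum U a R ∅ = Σ_{j mixed on R, 0 elsewhere} [(c(j[a↦1]) − c(j[a↦0])) + (c(j[a↦2]) − c(j[a↦3]))]` (`hmSum_empty_eq_sum_lines`), so the
end-order law of the three-copy comb array (`CombOrderOne 3`: `c_0 ≤ c_1`, `c_3 ≤ c_2` on every line; census-clean, `m ≤ 5` exhaustive,
ttrl topform) gives `0 ≤ hmSum U a R ∅` (`hmSum_empty_nonneg_of_combOrderOne`) and hence **`halfMix_of_combOrderOne : CombOrderOne 3 → HalfMix`**.
With `half_of_halfMix` and `SahiUniform.kahnConjecture_of_half` the tree's ladder reads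
`CombOrderOne 3 ⟹ HalfMix ⟹ SahiTwoLevelHalf.Half ⟹ KahnConjecture`, and HALF-MIX inherits every census of ORDER-1.
Pure proofs, no definitions; axioms standard; `CombOrderOne 3`, `HalfMix`, `Half`, `KahnConjecture` remain OPEN. [this work]
-/

noncomputable section

open scoped Classical

namespace Summit.CriticalPhenomena.PercolationContinuityZ3.Theorems

namespace SahiCombMix

open Finset Function
open Literature.Probability.Percolation.DecisionTree (ind)
open SahiComb

variable {ι : Type} [Fintype ι]

/-- **The base lettered sum is a sum of HALF letters of comb LINES**: `hmSum U a R ∅ = Σ_{j mixed on R, 0 elsewhere}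
[(c(j[a↦1]) − c(j[a↦0])) + (c(j[a↦2]) − c(j[a↦3]))]`. [this work] -/
theorem hmSum_empty_eq_sum_lines (U : Fin 3 → Set (Set ι)) {a : ι} {R : Finset ι} (haR : a ∉ R) :
    hmSum U a R ∅ = ∑ j ∈ box (update (fun _ : ι => (3 : ℕ)) a 0),
      if MixFree R ∅ j then
        (combCoeff 3 (fun i => ind (U i)) (update j a 1) - combCoeff 3 (fun i => ind (U i)) (update j a 0))
          + (combCoeff 3 (fun i => ind (U i)) (update j a 2) - combCoeff 3 (fun i => ind (U i)) (update j a 3))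
      else 0 := by
  have ha0 : a ∉ (∅ : Finset ι) := Finset.notMem_empty a
  set B := box (update (fun _ : ι => (3 : ℕ)) a 0) with hB
  have hB0 : ∀ j ∈ B, j a = 0 := fun j hj => apply_eq_zero_of_mem_box_update hj
  have hdig : ∀ t : ℕ, ∑ j ∈ B, (if MixFree R (insert a ∅) (update j a t) then
        halfLetter (update j a t a) * combCoeff 3 (fun i => ind (U i)) (update j a t) else 0)
      = ∑ j ∈ B, (if MixFree R ∅ j then halfLetter t * combCoeff 3 (fun i => ind (U i)) (update j a t) else 0) := by
    intro t
    refine sum_congr rfl fun j hj => ?_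
    rw [mixFree_insert_update_iff haR ha0 (hB0 j hj), update_self]
  have hε0 : halfLetter 0 = -1 := by simp [halfLetter]
  have hε1 : halfLetter 1 = 1 := by simp [halfLetter]
  have hε2 : halfLetter 2 = 1 := by simp [halfLetter]
  have hε3 : halfLetter 3 = -1 := by simp [halfLetter]
  unfold hmSum
  rw [sum_box_eq_sum_fiber_update (fun _ : ι => (3 : ℕ)) a]
  simp only [Finset.sum_range_succ, Finset.sum_range_zero, zero_add]
  rw [← hB, hdig 0, hdig 1, hdig 2, hdig 3, ← sum_add_distrib, ← sum_add_distrib, ← sum_add_distrib]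
  refine sum_congr rfl fun j _ => ?_
  split_ifs
  · rw [hε0, hε1, hε2, hε3]; ring
  · ring

/-- **ORDER-1 ⟹ the base lettered sum is `≥ 0`**: under `CombOrderOne 3` each line bracket `(c_1 − c_0) + (c_2 − c_3)` is `≥ 0`.
[this work] -/
theorem hmSum_empty_nonneg_of_combOrderOne (h : CombOrderOne 3) (U : Fin 3 → Set (Set ι)) (hU : ∀ i, IsUpperSet (U i))
    {a : ι} {R : Finset ι} (haR : a ∉ R) : 0 ≤ hmSum U a R ∅ := by
  rw [hmSum_empty_eq_sum_lines U haR]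
  refine sum_nonneg fun j _ => ?_
  split_ifs
  · obtain ⟨h01, h32⟩ := h (by norm_num) ι U hU a j
    have h32' : combLine 3 U a j 3 ≤ combLine 3 U a j 2 := by simpa using h32
    unfold combLine at h01 h32'
    linarith
  · exact le_rfl

end SahiCombMix

open SahiCombMix

/-- **ORDER-1(3) ⟹ HALF-MIX**: `CombOrderOne 3 → HalfMix` (so `CombOrderOne 3 ⟹ HalfMix ⟹ Half ⟹ KahnConjecture`). [this work] -/
theorem halfMix_of_combOrderOne (h : CombOrderOne 3) : HalfMix := by
  intro ι _ U hU R a haR _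
  have h0 := hmSum_empty_nonneg_of_combOrderOne h U hU haR
  rw [hmSum_empty_eq U haR] at h0
  linarith

end Summit.CriticalPhenomena.PercolationContinuityZ3.Theorems
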